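import Summits.QuantumFields.YangMills.Theorems.FluctuationComparisonRegPrIntLS2BetaConeOnBox
import Summits.QuantumFields.YangMills.Theorems.FluctuationComparisonRegPrIntLS2BetaBlockOffsetCoordinates
import HarnessLib

/-!
# S2β · D-GUARD ∕ (BG∞) — STAGE S ON A BOX-BLOCK ((L-S)′ of FINDING (BX) ∕ desk №132-A banked road: ✓p840333 (L-S) «STAGE S ON A BLOCK» re-cut over the BOX cone
# ✓∕⧗(R2-S) `exists_coneOnBox` — per-axis sides `(n₁, n₂, n₃)`, the cube operator replaced by the box operator `Wb` (binder, `hWb` = the body of `exists_coneOnBox`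
# VERBATIM), the block section PINNED by `hW : ∀ t, W t = Wb (box datum of t) (t α, t β, t γ)`; the PER-BOND shell letters feed (R2-S) (iii′) directly — the
# stage-3 reading that discharges px19 g25's per-axis filling letter `h₃` of `hSec_of_fillings` (px5 g24's ✓p840380 (R3) (L-T)′ ONE DIMENSION UP)

Cell `ym3-torus` (YM ladder rung R3 = continuum `SU(2)` Yang–Mills on the three-torus at fixed lattice data — a RUNG: NOT d = 4, NOT infinite volume,
NOT a mass gap, NOT Clay).  Width seat «width 8» `ym3-torus-px8` (gen 28, toron∕flux lineage ✓p826411 → px17 (W1) ✓p837971), FREE px helper on crux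
`stmt-QuantumFields-20520`; `--kind proof --supports stmt-QuantumFields-20520 --as helper`, count-neutral, DEFINITION-FREE (0 `def`, 0 `instance`, 0 `notation`,
0 `sorry`, default heartbeats).  px19 g25 02:58:38Z: «the four-file box road discharges FILL₃ under text v1 — agreed».

WHY.  `h₃` (STATUS 2026-09-01T02:55:11Z; ✓∕⧗`…SectionsOfFillings` §7) quantifies over boxes `∀ (n s : Fin P.d → ℕ), ρ ≤ n κ ∧ 3·n κ ≤ 4ρ + 3`: the stage-3 block of
the 8-colour gluing is `{0..n α} × {0..n β} × {0..n γ}` in offset coordinates, sides unequal in general.  Naming `α` the axis of the longest side `n₁` (so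
`n₂, n₃ ≤ n₁ ≤ 2n₂, 2n₃` by `omega` from the side law), (R2-S) supplies the box operator; THIS FILE reads it on the block exactly as ✓p840333 read the cube operator:
the box datum of an offset vector `t` is `ψ_t (i, k, l) := φ (t|_{α↦i, β↦k, γ↦l})`, a bond inside the block is ONE unit step of ONE offset (✓p839889 `read_tgt_eq`), an
`α`∕`β`∕`γ`-step keeps `ψ_t` (✓p840187 `cube_step_…`), and the per-bond shell letters in offset-vector currency ARE (R2-S) (iii′)'s three families (§1).  At `d = 3`
every bond of the block is in-box, so no transverse law is stated ((R2-S) (iv) stays inside `hWb` for a future `d ≥ 4` reader).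

WHAT IS PROVED (sorry-free; `Λ := (π − r)∕sin r`; «shell» of the box of `t` = `u α ≤ n₁ ∧ u β ≤ n₂ ∧ u γ ≤ n₃ ∧ (u α = 0 ∨ u α = n₁ ∨ u β = 0 ∨ u β = n₂ ∨ u γ = 0 ∨
u γ = n₃)`; «`u` in the box of `t`» = `update (update (update u α (t α)) β (t β)) γ (t γ) = t` — trivially true at `d = 3`; all hypotheses BOX-LOCAL).
* §1 READERS: `boxCap_of_shellCap` (offset shell cap ⟹ (R2-S)'s cap for `ψ_t`), `boxShell_h1∕h2∕h3_of_shellSteps` (offset per-bond shell letter `hstep` ⟹ (R2-S)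
  (iii′)'s three forward families for `ψ_t`).
* §2 OFFSET-LEVEL LAWS for `t α ≤ n₁, t β ≤ n₂, t γ ≤ n₃`: ★ `stageS_shell_eq` (`W t = φ t` on the shell — FILL₃ (i)), ★★ `norm_logVec_inv_stageS_le` (cap position),
  ★★★ `dist1_stageS_steps_le` (the `α`∕`β`∕`γ`-steps `≤ 24Λη + 6(π−r)∕n₁` from the shell cap + per-bond shell oscillation `η`).
* §3 BOND-LEVEL LAW: ★★★ `dist1_stageS_inbox_le (b) (hdir : b.dir = α ∨ b.dir = β ∨ b.dir = γ) (hN) (hα hβ hγ) (htgt : per-direction target inside) (hcap) (hη) (hstep) :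
  dist1 (W (t src)·(W (t tgt))⁻¹) ≤ 24Λη + 6(π−r)∕n₁` — FILL₃'s step clause before constants.

HONEST SCOPE.  Composition of landed∕pending sphere∕lattice geometry ((R2-S) over ✓p839993, ✓p840009, ✓p840271) with offset bookkeeping (✓p839889, ✓p840187); no
gauge field; nothing of Bałaban's renormalisation-group analysis is asserted or proved ([Balaban1985RegularSpaces] Lemma 1 p.79, (1.36) p.82, Thm 2 p.83 — local small
gauges).  `h₃` ∕ `hSec` ∕ (BG∞) ∕ `hBG` are HYPOTHESES∕CONJECTURES and NOT proved here (the numerics `∀ E, ∃ A ρ₀` are the next file's); GAP♯∘ (registry v11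
UNTOUCHED), the five registered stubs (0∕5), S2β, 20520, 19936, 19200, `YM3TorusSU2` are NOT proved; no registered stub is closed; rung R3 — NOT d = 4, NOT
infinite volume, NOT a mass gap, NOT Clay; the Yang–Mills mass gap is NOT proved.  Axioms standard.

References: T. Bałaban, CMP **99** (1985) 75–102 [Balaban1985RegularSpaces] (Lemma 1 p.79, (1.36) p.82, Thm 2 p.83).
-/

set_option autoImplicit false

noncomputable section

namespace Summit.QuantumFields.YangMills.Theorems.FluctuationComparisonRegPrIntLS2BetaSqrtGaugeStageSBoxBlock

open scoped Real
open Literature.MathematicalPhysics.QuantumLattice (su2Quat)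
open Literature.MathematicalPhysics.QuantumFieldTheory.Balaban1983to89
open T4CubeChartGnomonic (SU2)
open T4ExpWindowSmallField (logVec)
open Summit.QuantumFields.YangMills.Theorems.FluctuationComparisonRegPrIntLS2BetaCubeOffsetAlgebra
open Summit.QuantumFields.YangMills.Theorems.FluctuationComparisonRegPrIntLS2BetaBlockOffsetCoordinates (read_tgt_eq)

variable {P : Params} {j : ℕ}

section StageSBox

variable (φ : (Fin P.d → ℕ) → SU2) (a : SU2) (α β γ : Fin P.d) (n₁ n₂ n₃ : ℕ) (r : ℝ)
  (Wb : (ℕ × ℕ × ℕ → SU2) → (ℕ × ℕ × ℕ → SU2))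
  (hWb : ∀ ψ : ℕ × ℕ × ℕ → SU2,
      (∀ i k l, i ≤ n₁ → k ≤ n₂ → l ≤ n₃ → (i = 0 ∨ i = n₁ ∨ k = 0 ∨ k = n₂ ∨ l = 0 ∨ l = n₃) →
        ‖logVec (su2Quat (a⁻¹ * ψ (i, k, l)))‖ ≤ π - r) →
      (∀ i k l, i ≤ n₁ → k ≤ n₂ → l ≤ n₃ → (i = 0 ∨ i = n₁ ∨ k = 0 ∨ k = n₂ ∨ l = 0 ∨ l = n₃) → Wb ψ (i, k, l) = ψ (i, k, l)) ∧
      (∀ i k l, i ≤ n₁ → k ≤ n₂ → l ≤ n₃ → ‖logVec (su2Quat (a⁻¹ * Wb ψ (i, k, l)))‖ ≤ π - r) ∧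
      (∀ η : ℝ, 0 ≤ η →
        (∀ i k l, i + 1 ≤ n₁ → k ≤ n₂ → l ≤ n₃ → (i = 0 ∨ i = n₁ ∨ k = 0 ∨ k = n₂ ∨ l = 0 ∨ l = n₃) →
          (i + 1 = n₁ ∨ k = 0 ∨ k = n₂ ∨ l = 0 ∨ l = n₃) → dist1 (ψ (i, k, l) * (ψ (i + 1, k, l))⁻¹) ≤ η) →
        (∀ i k l, i ≤ n₁ → k + 1 ≤ n₂ → l ≤ n₃ → (i = 0 ∨ i = n₁ ∨ k = 0 ∨ k = n₂ ∨ l = 0 ∨ l = n₃) →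
          (i = 0 ∨ i = n₁ ∨ k + 1 = n₂ ∨ l = 0 ∨ l = n₃) → dist1 (ψ (i, k, l) * (ψ (i, k + 1, l))⁻¹) ≤ η) →
        (∀ i k l, i ≤ n₁ → k ≤ n₂ → l + 1 ≤ n₃ → (i = 0 ∨ i = n₁ ∨ k = 0 ∨ k = n₂ ∨ l = 0 ∨ l = n₃) →
          (i = 0 ∨ i = n₁ ∨ k = 0 ∨ k = n₂ ∨ l + 1 = n₃) → dist1 (ψ (i, k, l) * (ψ (i, k, l + 1))⁻¹) ≤ η) →
        (∀ i k l, i + 1 ≤ n₁ → k ≤ n₂ → l ≤ n₃ →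
          dist1 (Wb ψ (i, k, l) * (Wb ψ (i + 1, k, l))⁻¹) ≤ 24 * ((π - r) / Real.sin r) * η + 6 * (π - r) / n₁) ∧
        (∀ i k l, i ≤ n₁ → k + 1 ≤ n₂ → l ≤ n₃ →
          dist1 (Wb ψ (i, k, l) * (Wb ψ (i, k + 1, l))⁻¹) ≤ 24 * ((π - r) / Real.sin r) * η + 6 * (π - r) / n₁) ∧
        (∀ i k l, i ≤ n₁ → k ≤ n₂ → l + 1 ≤ n₃ →
          dist1 (Wb ψ (i, k, l) * (Wb ψ (i, k, l + 1))⁻¹) ≤ 24 * ((π - r) / Real.sin r) * η + 6 * (π - r) / n₁)) ∧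
      (∀ ψ' : ℕ × ℕ × ℕ → SU2, ∀ μ : ℝ,
        (∀ i k l, i ≤ n₁ → k ≤ n₂ → l ≤ n₃ → (i = 0 ∨ i = n₁ ∨ k = 0 ∨ k = n₂ ∨ l = 0 ∨ l = n₃) →
          ‖logVec (su2Quat (a⁻¹ * ψ' (i, k, l)))‖ ≤ π - r) →
        (∀ i k l, i ≤ n₁ → k ≤ n₂ → l ≤ n₃ → (i = 0 ∨ i = n₁ ∨ k = 0 ∨ k = n₂ ∨ l = 0 ∨ l = n₃) →
          dist1 (ψ (i, k, l) * (ψ' (i, k, l))⁻¹) ≤ μ) →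
        ∀ i k l, i ≤ n₁ → k ≤ n₂ → l ≤ n₃ → dist1 (Wb ψ (i, k, l) * (Wb ψ' (i, k, l))⁻¹) ≤ ((π - r) / Real.sin r) * μ))
  (W : (Fin P.d → ℕ) → SU2)
  (hW : ∀ t : Fin P.d → ℕ, W t =
    Wb (fun p => φ (Function.update (Function.update (Function.update t α p.1) β p.2.1) γ p.2.2)) (t α, t β, t γ))

/-! ## §1 Readers: shell cap and shell letters of the box datum from offset-level hypotheses -/

/-- The shell cap of the box of `t`, read as the cap hypothesis of (R2-S) for the box datum `ψ_t`. [folklore] -/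
theorem boxCap_of_shellCap (hαβ : α ≠ β) (hαγ : α ≠ γ) (hβγ : β ≠ γ) (t : Fin P.d → ℕ)
    (hcap : ∀ u : Fin P.d → ℕ, Function.update (Function.update (Function.update u α (t α)) β (t β)) γ (t γ) = t →
      u α ≤ n₁ → u β ≤ n₂ → u γ ≤ n₃ → (u α = 0 ∨ u α = n₁ ∨ u β = 0 ∨ u β = n₂ ∨ u γ = 0 ∨ u γ = n₃) →
      ‖logVec (su2Quat (a⁻¹ * φ u))‖ ≤ π - r) :
    ∀ i k l, i ≤ n₁ → k ≤ n₂ → l ≤ n₃ → (i = 0 ∨ i = n₁ ∨ k = 0 ∨ k = n₂ ∨ l = 0 ∨ l = n₃) →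
      ‖logVec (su2Quat (a⁻¹ * (fun p : ℕ × ℕ × ℕ =>
        φ (Function.update (Function.update (Function.update t α p.1) β p.2.1) γ p.2.2)) (i, k, l)))‖ ≤ π - r := by
  intro i k l hi hk hl hb
  have h := hcap (Function.update (Function.update (Function.update t α i) β k) γ l) (uuu_mem_cube t hαβ hαγ hβγ i k l)
  rw [uuu_apply_fst t hαβ hαγ, uuu_apply_snd t α hβγ, uuu_apply_thd] at h
  exact h hi hk hl hb

/-- The PER-BOND shell letters of the box of `t` (offset-vector currency), read as (R2-S) (iii′)'s first-direction letters for the box datum `ψ_t`. [folklore] -/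
theorem boxShell_h1_of_shellSteps (hαβ : α ≠ β) (hαγ : α ≠ γ) (hβγ : β ≠ γ) (t : Fin P.d → ℕ) {η : ℝ}
    (hstep : ∀ u : Fin P.d → ℕ, ∀ κ : Fin P.d, (κ = α ∨ κ = β ∨ κ = γ) →
      Function.update (Function.update (Function.update u α (t α)) β (t β)) γ (t γ) = t →
      u α ≤ n₁ → u β ≤ n₂ → u γ ≤ n₃ → (u α = 0 ∨ u α = n₁ ∨ u β = 0 ∨ u β = n₂ ∨ u γ = 0 ∨ u γ = n₃) →
      Function.update u κ (u κ + 1) α ≤ n₁ → Function.update u κ (u κ + 1) β ≤ n₂ → Function.update u κ (u κ + 1) γ ≤ n₃ →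
      (Function.update u κ (u κ + 1) α = 0 ∨ Function.update u κ (u κ + 1) α = n₁ ∨
        Function.update u κ (u κ + 1) β = 0 ∨ Function.update u κ (u κ + 1) β = n₂ ∨
        Function.update u κ (u κ + 1) γ = 0 ∨ Function.update u κ (u κ + 1) γ = n₃) →
      dist1 (φ u * (φ (Function.update u κ (u κ + 1)))⁻¹) ≤ η) :
    ∀ i k l, i + 1 ≤ n₁ → k ≤ n₂ → l ≤ n₃ → (i = 0 ∨ i = n₁ ∨ k = 0 ∨ k = n₂ ∨ l = 0 ∨ l = n₃) →
      (i + 1 = n₁ ∨ k = 0 ∨ k = n₂ ∨ l = 0 ∨ l = n₃) →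
      dist1 ((fun p : ℕ × ℕ × ℕ => φ (Function.update (Function.update (Function.update t α p.1) β p.2.1) γ p.2.2)) (i, k, l) *
        ((fun p : ℕ × ℕ × ℕ => φ (Function.update (Function.update (Function.update t α p.1) β p.2.1) γ p.2.2)) (i + 1, k, l))⁻¹) ≤ η := by
  intro i k l hi hk hl hb hb'
  have h := hstep (Function.update (Function.update (Function.update t α i) β k) γ l) α (Or.inl rfl) (uuu_mem_cube t hαβ hαγ hβγ i k l)
  rw [uuu_step_fst t hαβ hαγ, uuu_apply_fst t hαβ hαγ, uuu_apply_snd t α hβγ, uuu_apply_thd,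
    uuu_apply_fst t hαβ hαγ, uuu_apply_snd t α hβγ, uuu_apply_thd] at h
  exact h (by omega) hk hl hb hi hk hl (by omega)

/-- The same for the second direction. [folklore] -/
theorem boxShell_h2_of_shellSteps (hαβ : α ≠ β) (hαγ : α ≠ γ) (hβγ : β ≠ γ) (t : Fin P.d → ℕ) {η : ℝ}
    (hstep : ∀ u : Fin P.d → ℕ, ∀ κ : Fin P.d, (κ = α ∨ κ = β ∨ κ = γ) →
      Function.update (Function.update (Function.update u α (t α)) β (t β)) γ (t γ) = t →
      u α ≤ n₁ → u β ≤ n₂ → u γ ≤ n₃ → (u α = 0 ∨ u α = n₁ ∨ u β = 0 ∨ u β = n₂ ∨ u γ = 0 ∨ u γ = n₃) →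
      Function.update u κ (u κ + 1) α ≤ n₁ → Function.update u κ (u κ + 1) β ≤ n₂ → Function.update u κ (u κ + 1) γ ≤ n₃ →
      (Function.update u κ (u κ + 1) α = 0 ∨ Function.update u κ (u κ + 1) α = n₁ ∨
        Function.update u κ (u κ + 1) β = 0 ∨ Function.update u κ (u κ + 1) β = n₂ ∨
        Function.update u κ (u κ + 1) γ = 0 ∨ Function.update u κ (u κ + 1) γ = n₃) →
      dist1 (φ u * (φ (Function.update u κ (u κ + 1)))⁻¹) ≤ η) :
    ∀ i k l, i ≤ n₁ → k + 1 ≤ n₂ → l ≤ n₃ → (i = 0 ∨ i = n₁ ∨ k = 0 ∨ k = n₂ ∨ l = 0 ∨ l = n₃) →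
      (i = 0 ∨ i = n₁ ∨ k + 1 = n₂ ∨ l = 0 ∨ l = n₃) →
      dist1 ((fun p : ℕ × ℕ × ℕ => φ (Function.update (Function.update (Function.update t α p.1) β p.2.1) γ p.2.2)) (i, k, l) *
        ((fun p : ℕ × ℕ × ℕ => φ (Function.update (Function.update (Function.update t α p.1) β p.2.1) γ p.2.2)) (i, k + 1, l))⁻¹) ≤ η := by
  intro i k l hi hk hl hb hb'
  have h := hstep (Function.update (Function.update (Function.update t α i) β k) γ l) β (Or.inr (Or.inl rfl))
    (uuu_mem_cube t hαβ hαγ hβγ i k l)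
  rw [uuu_step_snd t α hβγ, uuu_apply_fst t hαβ hαγ, uuu_apply_snd t α hβγ, uuu_apply_thd,
    uuu_apply_fst t hαβ hαγ, uuu_apply_snd t α hβγ, uuu_apply_thd] at h
  exact h hi (by omega) hl hb hi hk hl (by omega)

/-- The same for the third direction. [folklore] -/
theorem boxShell_h3_of_shellSteps (hαβ : α ≠ β) (hαγ : α ≠ γ) (hβγ : β ≠ γ) (t : Fin P.d → ℕ) {η : ℝ}
    (hstep : ∀ u : Fin P.d → ℕ, ∀ κ : Fin P.d, (κ = α ∨ κ = β ∨ κ = γ) →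
      Function.update (Function.update (Function.update u α (t α)) β (t β)) γ (t γ) = t →
      u α ≤ n₁ → u β ≤ n₂ → u γ ≤ n₃ → (u α = 0 ∨ u α = n₁ ∨ u β = 0 ∨ u β = n₂ ∨ u γ = 0 ∨ u γ = n₃) →
      Function.update u κ (u κ + 1) α ≤ n₁ → Function.update u κ (u κ + 1) β ≤ n₂ → Function.update u κ (u κ + 1) γ ≤ n₃ →
      (Function.update u κ (u κ + 1) α = 0 ∨ Function.update u κ (u κ + 1) α = n₁ ∨
        Function.update u κ (u κ + 1) β = 0 ∨ Function.update u κ (u κ + 1) β = n₂ ∨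
        Function.update u κ (u κ + 1) γ = 0 ∨ Function.update u κ (u κ + 1) γ = n₃) →
      dist1 (φ u * (φ (Function.update u κ (u κ + 1)))⁻¹) ≤ η) :
    ∀ i k l, i ≤ n₁ → k ≤ n₂ → l + 1 ≤ n₃ → (i = 0 ∨ i = n₁ ∨ k = 0 ∨ k = n₂ ∨ l = 0 ∨ l = n₃) →
      (i = 0 ∨ i = n₁ ∨ k = 0 ∨ k = n₂ ∨ l + 1 = n₃) →
      dist1 ((fun p : ℕ × ℕ × ℕ => φ (Function.update (Function.update (Function.update t α p.1) β p.2.1) γ p.2.2)) (i, k, l) *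
        ((fun p : ℕ × ℕ × ℕ => φ (Function.update (Function.update (Function.update t α p.1) β p.2.1) γ p.2.2)) (i, k, l + 1))⁻¹) ≤ η := by
  intro i k l hi hk hl hb hb'
  have h := hstep (Function.update (Function.update (Function.update t α i) β k) γ l) γ (Or.inr (Or.inr rfl))
    (uuu_mem_cube t hαβ hαγ hβγ i k l)
  rw [uuu_step_thd t α β γ, uuu_apply_fst t hαβ hαγ, uuu_apply_snd t α hβγ, uuu_apply_thd,
    uuu_apply_fst t hαβ hαγ, uuu_apply_snd t α hβγ, uuu_apply_thd] at h
  exact h hi hk (by omega) hb hi hk hl (by omega)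

/-! ## §2 Offset-level laws -/

include hW hWb in
/-- ★ **THE SHELL AGREEMENT** ((DESC₃)∕FILL₃ (i)): on the shell of its box (`t α ≤ n₁, t β ≤ n₂, t γ ≤ n₃`, one of them at an end), with the box's shell data inside
the cap of `a`, the section is the datum: `W t = φ t`. [folklore] -/
theorem stageS_shell_eq (hαβ : α ≠ β) (hαγ : α ≠ γ) (hβγ : β ≠ γ) (t : Fin P.d → ℕ) (hα : t α ≤ n₁) (hβ : t β ≤ n₂) (hγ : t γ ≤ n₃)
    (hshell : t α = 0 ∨ t α = n₁ ∨ t β = 0 ∨ t β = n₂ ∨ t γ = 0 ∨ t γ = n₃)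
    (hcap : ∀ u : Fin P.d → ℕ, Function.update (Function.update (Function.update u α (t α)) β (t β)) γ (t γ) = t →
      u α ≤ n₁ → u β ≤ n₂ → u γ ≤ n₃ → (u α = 0 ∨ u α = n₁ ∨ u β = 0 ∨ u β = n₂ ∨ u γ = 0 ∨ u γ = n₃) →
      ‖logVec (su2Quat (a⁻¹ * φ u))‖ ≤ π - r) :
    W t = φ t := by
  rw [hW t, (hWb (fun p => φ (Function.update (Function.update (Function.update t α p.1) β p.2.1) γ p.2.2))
    (boxCap_of_shellCap φ a α β γ n₁ n₂ n₃ r hαβ hαγ hβγ t hcap)).1 (t α) (t β) (t γ) hα hβ hγ hshell]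
  simp only [Function.update_eq_self]

include hW hWb in
/-- ★★ **THE CAP POSITION**: everywhere on the box of `t`, with the box's shell data inside the cap of `a`, `‖logVec (a⁻¹·W t)‖ ≤ π − r`. [folklore] -/
theorem norm_logVec_inv_stageS_le (hαβ : α ≠ β) (hαγ : α ≠ γ) (hβγ : β ≠ γ) (t : Fin P.d → ℕ) (hα : t α ≤ n₁) (hβ : t β ≤ n₂) (hγ : t γ ≤ n₃)
    (hcap : ∀ u : Fin P.d → ℕ, Function.update (Function.update (Function.update u α (t α)) β (t β)) γ (t γ) = t →
      u α ≤ n₁ → u β ≤ n₂ → u γ ≤ n₃ → (u α = 0 ∨ u α = n₁ ∨ u β = 0 ∨ u β = n₂ ∨ u γ = 0 ∨ u γ = n₃) →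
      ‖logVec (su2Quat (a⁻¹ * φ u))‖ ≤ π - r) :
    ‖logVec (su2Quat (a⁻¹ * W t))‖ ≤ π - r := by
  rw [hW t]
  exact (hWb (fun p => φ (Function.update (Function.update (Function.update t α p.1) β p.2.1) γ p.2.2))
    (boxCap_of_shellCap φ a α β γ n₁ n₂ n₃ r hαβ hαγ hβγ t hcap)).2.1 (t α) (t β) (t γ) hα hβ hγ

include hW hWb in
/-- ★★★ **THE IN-BOX STEPS**: for an offset vector `t` inside the box, the box's shell data inside the cap of `a` and with PER-BOND shell oscillation `≤ η`: the
`α`-, `β`- and `γ`-steps of the section each cost `≤ 24·((π−r)∕sin r)·η + 6(π−r)∕n₁` ((R2-S) (iii′)). [cite: Balaban1985RegularSpaces, Thm 2 p.83] -/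
theorem dist1_stageS_steps_le (hαβ : α ≠ β) (hαγ : α ≠ γ) (hβγ : β ≠ γ) (t : Fin P.d → ℕ) (hα : t α ≤ n₁) (hβ : t β ≤ n₂) (hγ : t γ ≤ n₃)
    (hcap : ∀ u : Fin P.d → ℕ, Function.update (Function.update (Function.update u α (t α)) β (t β)) γ (t γ) = t →
      u α ≤ n₁ → u β ≤ n₂ → u γ ≤ n₃ → (u α = 0 ∨ u α = n₁ ∨ u β = 0 ∨ u β = n₂ ∨ u γ = 0 ∨ u γ = n₃) →
      ‖logVec (su2Quat (a⁻¹ * φ u))‖ ≤ π - r)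
    {η : ℝ} (hη : 0 ≤ η)
    (hstep : ∀ u : Fin P.d → ℕ, ∀ κ : Fin P.d, (κ = α ∨ κ = β ∨ κ = γ) →
      Function.update (Function.update (Function.update u α (t α)) β (t β)) γ (t γ) = t →
      u α ≤ n₁ → u β ≤ n₂ → u γ ≤ n₃ → (u α = 0 ∨ u α = n₁ ∨ u β = 0 ∨ u β = n₂ ∨ u γ = 0 ∨ u γ = n₃) →
      Function.update u κ (u κ + 1) α ≤ n₁ → Function.update u κ (u κ + 1) β ≤ n₂ → Function.update u κ (u κ + 1) γ ≤ n₃ →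
      (Function.update u κ (u κ + 1) α = 0 ∨ Function.update u κ (u κ + 1) α = n₁ ∨
        Function.update u κ (u κ + 1) β = 0 ∨ Function.update u κ (u κ + 1) β = n₂ ∨
        Function.update u κ (u κ + 1) γ = 0 ∨ Function.update u κ (u κ + 1) γ = n₃) →
      dist1 (φ u * (φ (Function.update u κ (u κ + 1)))⁻¹) ≤ η) :
    (t α + 1 ≤ n₁ → dist1 (W t * (W (Function.update t α (t α + 1)))⁻¹) ≤ 24 * ((π - r) / Real.sin r) * η + 6 * (π - r) / n₁) ∧
    (t β + 1 ≤ n₂ → dist1 (W t * (W (Function.update t β (t β + 1)))⁻¹) ≤ 24 * ((π - r) / Real.sin r) * η + 6 * (π - r) / n₁) ∧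
    (t γ + 1 ≤ n₃ → dist1 (W t * (W (Function.update t γ (t γ + 1)))⁻¹) ≤ 24 * ((π - r) / Real.sin r) * η + 6 * (π - r) / n₁) := by
  have h := (hWb (fun p => φ (Function.update (Function.update (Function.update t α p.1) β p.2.1) γ p.2.2))
    (boxCap_of_shellCap φ a α β γ n₁ n₂ n₃ r hαβ hαγ hβγ t hcap)).2.2.1 η hη
    (boxShell_h1_of_shellSteps φ α β γ n₁ n₂ n₃ hαβ hαγ hβγ t hstep)
    (boxShell_h2_of_shellSteps φ α β γ n₁ n₂ n₃ hαβ hαγ hβγ t hstep)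
    (boxShell_h3_of_shellSteps φ α β γ n₁ n₂ n₃ hαβ hαγ hβγ t hstep)
  refine ⟨fun hα1 => ?_, fun hβ1 => ?_, fun hγ1 => ?_⟩
  · rw [hW t, hW (Function.update t α (t α + 1)), cube_step_fst φ t α β γ, Function.update_self,
      Function.update_of_ne (Ne.symm hαβ), Function.update_of_ne (Ne.symm hαγ)]
    exact h.1 (t α) (t β) (t γ) hα1 hβ hγ
  · rw [hW t, hW (Function.update t β (t β + 1)), cube_step_snd φ t γ hαβ, Function.update_self,
      Function.update_of_ne hαβ, Function.update_of_ne (Ne.symm hβγ)]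
    exact h.2.1 (t α) (t β) (t γ) hα hβ1 hγ
  · rw [hW t, hW (Function.update t γ (t γ + 1)), cube_step_thd φ t hαγ hβγ, Function.update_self,
      Function.update_of_ne hαγ, Function.update_of_ne hβγ]
    exact h.2.2 (t α) (t β) (t γ) hα hβ hγ1

/-! ## §3 Bond-level law (sites, bonds, offsets as in (L-I)∕(L-T)∕(L-S)) -/

variable (s : Fin P.d → ℕ)

include hW hWb in
/-- ★★★ **THE IN-BOX BOND STEP**: along a bond `b` in direction `α`, `β` or `γ` inside the box of its source (source offsets `≤ (n₁, n₂, n₃)`, target offset inside, no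
wrap), with the box's shell data inside the cap of `a` and of per-bond oscillation `≤ η`: `dist1 (W (t src)·(W (t tgt))⁻¹) ≤ 24·((π−r)∕sin r)·η + 6(π−r)∕n₁`.
[cite: Balaban1985RegularSpaces, Thm 2 p.83] -/
theorem dist1_stageS_inbox_le (hαβ : α ≠ β) (hαγ : α ≠ γ) (hβγ : β ≠ γ) (b : PBond P j) (hdir : b.dir = α ∨ b.dir = β ∨ b.dir = γ)
    (hN : (b.src b.dir - ((s b.dir : ℕ) : ZMod (P.sitesPerDir j))).val + 1 < P.sitesPerDir j)
    (hα : (b.src α - ((s α : ℕ) : ZMod (P.sitesPerDir j))).val ≤ n₁) (hβ : (b.src β - ((s β : ℕ) : ZMod (P.sitesPerDir j))).val ≤ n₂)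
    (hγ : (b.src γ - ((s γ : ℕ) : ZMod (P.sitesPerDir j))).val ≤ n₃)
    (htgt : (b.dir = α → (b.src α - ((s α : ℕ) : ZMod (P.sitesPerDir j))).val + 1 ≤ n₁) ∧
      (b.dir = β → (b.src β - ((s β : ℕ) : ZMod (P.sitesPerDir j))).val + 1 ≤ n₂) ∧
      (b.dir = γ → (b.src γ - ((s γ : ℕ) : ZMod (P.sitesPerDir j))).val + 1 ≤ n₃))
    (hcap : ∀ u : Fin P.d → ℕ,
      Function.update (Function.update (Function.update u α ((b.src α - ((s α : ℕ) : ZMod (P.sitesPerDir j))).val))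
          β ((b.src β - ((s β : ℕ) : ZMod (P.sitesPerDir j))).val)) γ ((b.src γ - ((s γ : ℕ) : ZMod (P.sitesPerDir j))).val)
        = (fun κ => (b.src κ - ((s κ : ℕ) : ZMod (P.sitesPerDir j))).val) →
      u α ≤ n₁ → u β ≤ n₂ → u γ ≤ n₃ → (u α = 0 ∨ u α = n₁ ∨ u β = 0 ∨ u β = n₂ ∨ u γ = 0 ∨ u γ = n₃) →
      ‖logVec (su2Quat (a⁻¹ * φ u))‖ ≤ π - r)
    {η : ℝ} (hη : 0 ≤ η)
    (hstep : ∀ u : Fin P.d → ℕ, ∀ κ : Fin P.d, (κ = α ∨ κ = β ∨ κ = γ) →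
      Function.update (Function.update (Function.update u α ((b.src α - ((s α : ℕ) : ZMod (P.sitesPerDir j))).val))
          β ((b.src β - ((s β : ℕ) : ZMod (P.sitesPerDir j))).val)) γ ((b.src γ - ((s γ : ℕ) : ZMod (P.sitesPerDir j))).val)
        = (fun κ => (b.src κ - ((s κ : ℕ) : ZMod (P.sitesPerDir j))).val) →
      u α ≤ n₁ → u β ≤ n₂ → u γ ≤ n₃ → (u α = 0 ∨ u α = n₁ ∨ u β = 0 ∨ u β = n₂ ∨ u γ = 0 ∨ u γ = n₃) →
      Function.update u κ (u κ + 1) α ≤ n₁ → Function.update u κ (u κ + 1) β ≤ n₂ → Function.update u κ (u κ + 1) γ ≤ n₃ →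
      (Function.update u κ (u κ + 1) α = 0 ∨ Function.update u κ (u κ + 1) α = n₁ ∨
        Function.update u κ (u κ + 1) β = 0 ∨ Function.update u κ (u κ + 1) β = n₂ ∨
        Function.update u κ (u κ + 1) γ = 0 ∨ Function.update u κ (u κ + 1) γ = n₃) →
      dist1 (φ u * (φ (Function.update u κ (u κ + 1)))⁻¹) ≤ η) :
    dist1 (W (fun κ => (b.src κ - ((s κ : ℕ) : ZMod (P.sitesPerDir j))).val) *
      (W (fun κ => (b.tgt κ - ((s κ : ℕ) : ZMod (P.sitesPerDir j))).val))⁻¹) ≤ 24 * ((π - r) / Real.sin r) * η + 6 * (π - r) / n₁ := by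
  rw [read_tgt_eq W s b hN]
  set t : Fin P.d → ℕ := fun κ => (b.src κ - ((s κ : ℕ) : ZMod (P.sitesPerDir j))).val with ht
  have h := dist1_stageS_steps_le φ a α β γ n₁ n₂ n₃ r Wb hWb W hW hαβ hαγ hβγ t hα hβ hγ hcap hη hstep
  obtain ⟨h1, h2, h3⟩ := htgt
  rcases hdir with hdir | hdir | hdir
  · have h1' := h1 hdir; rw [hdir]; exact h.1 h1'
  · have h2' := h2 hdir; rw [hdir]; exact h.2.1 h2'
  · have h3' := h3 hdir; rw [hdir]; exact h.2.2 h3'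

end StageSBox

end Summit.QuantumFields.YangMills.Theorems.FluctuationComparisonRegPrIntLS2BetaSqrtGaugeStageSBoxBlock

end
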